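import Summits.RiemannHypothesis.RiemannHypothesis.Theorems.SuzukiFlowPairingGaussInner

/-!
# Operator side of `FlowPairing`: continuity of causal exponential averages, all weights (column DBR; RH-FREE)

RH-FREE throughout; nothing here bears on the truth of RH.  `Theorems.SuzukiFlowPairingGaussInner` proves that
`x ↦ ∫₀^∞ e^{av} g(x−v) dv` is continuous for `a < 0` and `g` bounded on half-lines.  The polar piece `a = +½` of
the flow kernel (`flowKernel_eq`) needs the complementary fact: for CAUSAL `g` (`g = 0` on `(−∞, −c]`) the
`v`-integration is effectively over `(0, x + c)` and EVERY real weight `a` is allowed: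

* `continuous_integral_exp_mul_shift_of_causal` — `g` continuous, `g(w) = 0` for `w ≤ −c` ⇒
  `x ↦ ∫₀^∞ e^{av} g(x − v) dv` continuous for every real `a`;
* `continuous_expPiece_limKernel` (`g = K_θ`, `c = 0`) and `continuous_expPiece_winOp` (`g = 𝖪_θ[t]f`, `c = t`,
  causality `winOp_limKernel_eq_zero_of_le`) — the measurability/integrability inputs for splitting
  `⟨𝖪_θ[t]f, 𝒥_θ[t]f⟩` into its five explicit-formula pieces (the assembly of `FlowPairing`).

References: [Su20] M. Suzuki, ASPM 84 (2020), (1.4), (1.9).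
-/

noncomputable section

-- D-0017: `Summit.<S>.<S>.…` is the designed namespace of a single-problem summit.
set_option linter.dupNamespace false

open Complex MeasureTheory Set Filter Topology
open scoped Real

namespace Summit.RiemannHypothesis.RiemannHypothesis.Theorems.SuzukiThetaFlow

open Literature.NumberTheory.LFunctions
open Summit.RiemannHypothesis.RiemannHypothesis.Theorems.SuzukiKernelSemigroup
open Summit.RiemannHypothesis.RiemannHypothesis.Theorems.SuzukiFlowPairing

variable {θ t : ℝ} {f : ℝ → ℝ}

/-- RH-FREE.  **Causal exponential averages are continuous, for every real weight**: if `g` is continuous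
and vanishes on `(−∞, −c]`, then `x ↦ ∫₀^∞ e^{av} g(x − v) dv` is continuous (dominated convergence; near `x₀`
the integrand lives on `v ≤ x₀ + 1 + c` and is bounded there by `e^{|a|v}·sup|g|`). -/
theorem continuous_integral_exp_mul_shift_of_causal {g : ℝ → ℝ} (hg : Continuous g) {c : ℝ}
    (h0 : ∀ w : ℝ, w ≤ -c → g w = 0) (a : ℝ) :
    Continuous fun x : ℝ ↦ ∫ v in Ioi (0 : ℝ), Real.exp (a * v) * g (x - v) := by
  refine continuous_iff_continuousAt.2 fun x₀ ↦ ?_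
  -- `g` is bounded on `(−∞, x₀ + 1]`: zero below `−c`, continuous on `[−c, x₀+1]`
  obtain ⟨M, hM⟩ : ∃ M : ℝ, ∀ w : ℝ, w ≤ x₀ + 1 → |g w| ≤ M := by
    obtain ⟨M, hM⟩ := (isCompact_Icc (a := -c) (b := x₀ + 1)).exists_bound_of_continuousOn hg.continuousOn
    refine ⟨max M 0, fun w hw ↦ ?_⟩
    rcases le_or_gt w (-c) with h | h
    · rw [h0 w h, abs_zero]; exact le_max_right _ _
    · have := hM w ⟨h.le, hw⟩
      rw [Real.norm_eq_abs] at this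
      exact this.trans (le_max_left _ _)
  have hM0 : 0 ≤ M := (abs_nonneg _).trans (hM (-c - |c| - |x₀| - 1) (by linarith [abs_nonneg c, neg_abs_le x₀, abs_nonneg x₀, neg_abs_le c]))
  set R : ℝ := x₀ + 1 + c with hR
  set bound : ℝ → ℝ := fun v ↦ (Iic R).indicator (fun v ↦ Real.exp (|a| * v) * M) v with hbound
  have hbi : Integrable bound (volume.restrict (Ioi (0 : ℝ))) := by
    rw [hbound]
    refine (integrable_indicator_iff measurableSet_Iic).2 ?_
    rw [IntegrableOn, Measure.restrict_restrict measurableSet_Iic,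
      show Iic R ∩ Ioi (0 : ℝ) = Ioc 0 R by ext v; simp [and_comm]]
    exact (((Real.continuous_exp.comp (by fun_prop)).mul continuous_const).integrableOn_Icc).mono_set
      Ioc_subset_Icc_self
  refine continuousAt_of_dominated (bound := bound) ?_ ?_ hbi ?_
  · exact Eventually.of_forall fun x ↦
      ((Real.continuous_exp.comp (by fun_prop)).mul (hg.comp (by fun_prop))).aestronglyMeasurable
  · have hnhds : Iio (x₀ + 1) ∈ 𝓝 x₀ := Iio_mem_nhds (by linarith)
    filter_upwards [hnhds] with x hx
    refine (ae_restrict_iff' measurableSet_Ioi).2 (Eventually.of_forall fun v hv ↦ ?_)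
    have hv0 : 0 < v := mem_Ioi.1 hv
    rw [norm_mul, Real.norm_eq_abs, Real.norm_eq_abs, Real.abs_exp, hbound]
    dsimp only
    rcases le_or_gt v R with hvR | hvR
    · rw [Set.indicator_of_mem (mem_Iic.2 hvR)]
      have h1 : Real.exp (a * v) ≤ Real.exp (|a| * v) :=
        Real.exp_le_exp.2 (by nlinarith [le_abs_self a, hv0])
      exact mul_le_mul h1 (hM _ (by linarith [mem_Iio.1 hx])) (abs_nonneg _) (Real.exp_pos _).le
    · rw [Set.indicator_of_notMem (fun h ↦ not_le.2 hvR (mem_Iic.1 h)),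
        h0 (x - v) (by rw [hR] at hvR; linarith [mem_Iio.1 hx]), abs_zero, mul_zero]
  · exact Eventually.of_forall fun v ↦
      ((continuous_const.mul (hg.comp (continuous_id.sub continuous_const))).continuousAt)

/-- RH-FREE.  The exponential pieces `w ↦ ∫₀^∞ e^{av} K_θ(w−v) dv` of the flow kernel are continuous for every
real `a` (causality of `K_θ`, `c = 0`). -/
theorem continuous_expPiece_limKernel (hθ : 1 < θ) (a : ℝ) :
    Continuous fun w : ℝ ↦ ∫ v in Ioi (0 : ℝ), Real.exp (a * v) * limKernel θ (w - v) :=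
  continuous_integral_exp_mul_shift_of_causal (Suzuki2020_thm12_continuous hθ) (c := 0)
    (fun _ hw ↦ limKernel_eq_zero_of_nonpos hθ (by simpa using hw)) a

/-- RH-FREE.  The exponential pieces `x ↦ ∫₀^∞ e^{av} (𝖪_θ[t]f)(x−v) dv` of the output are continuous for
every real `a` (causality of the output, `c = t`). -/
theorem continuous_expPiece_winOp (hθ : 1 < θ) (hf : IntegrableOn f (Ioo (-t) t)) (a : ℝ) :
    Continuous fun x : ℝ ↦ ∫ v in Ioi (0 : ℝ), Real.exp (a * v) * winOp (limKernel θ) t f (x - v) :=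
  continuous_integral_exp_mul_shift_of_causal (continuous_winOp hθ hf) (c := t)
    (fun _ hw ↦ winOp_limKernel_eq_zero_of_le hθ hw f) a

/-- RH-FREE.  Hence the exponential pieces of `J_θ` are integrable against `f` on the window (inner
integrability for the assembly): `y ↦ (∫₀^∞ e^{av}K_θ(x+y−v)dv)·f(y)` is integrable on `(−t,t)`. -/
theorem integrableOn_expPiece_mul (hθ : 1 < θ) (hf : IntegrableOn f (Ioo (-t) t)) (a x : ℝ) :
    IntegrableOn (fun y ↦ (∫ v in Ioi (0 : ℝ), Real.exp (a * v) * limKernel θ (x + y - v)) * f y) (Ioo (-t) t) := by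
  have hc : Continuous fun y : ℝ ↦ ∫ v in Ioi (0 : ℝ), Real.exp (a * v) * limKernel θ (x + y - v) :=
    (continuous_expPiece_limKernel hθ a).comp (continuous_const.add continuous_id)
  obtain ⟨M, hM⟩ := (isCompact_Icc (a := -t) (b := t)).exists_bound_of_continuousOn hc.continuousOn
  refine Integrable.bdd_mul (c := M) hf hc.aestronglyMeasurable ?_
  exact (ae_restrict_iff' measurableSet_Ioo).2 (Eventually.of_forall fun y hy ↦ hM y (Ioo_subset_Icc_self hy))

/-- RH-FREE.  … and the outer integrands `x ↦ G(x)·∫₀^∞ e^{av}G(x−v)dv` are integrable on the window. -/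
theorem integrableOn_winOp_mul_expPiece (hθ : 1 < θ) (hf : IntegrableOn f (Ioo (-t) t)) (a : ℝ) :
    IntegrableOn (fun x ↦ winOp (limKernel θ) t f x *
      ∫ v in Ioi (0 : ℝ), Real.exp (a * v) * winOp (limKernel θ) t f (x - v)) (Ioo (-t) t) :=
  (((continuous_winOp hθ hf).mul (continuous_expPiece_winOp hθ hf a)).continuousOn.integrableOn_compact
    isCompact_Icc).mono_set Ioo_subset_Icc_self

end Summit.RiemannHypothesis.RiemannHypothesis.Theorems.SuzukiThetaFlow

end
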